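import Summits.QuantumFields.YangMills.Theorems.BalabanUVNodesN07Thm1Top7FromProp8
import Literature.MathematicalPhysics.QuantumFieldTheory.Balaban1983to89.Node00.Record12BgRowCoClassCPMFloorB

/-!
# BalabanUVNodes ∕ N07 ([Balaban1985Variational] Thm 1 (6)–(8) ∕ Prop. 8 p. 304) — THE GUARDED (8)-SENTENCE OVER A **BOND-LEVEL DETERMINING DATUM** AND A **TOP-DATA PREDICATE**
# `VariationalThm1RegSepTop7MGB ∕ …CoP7MGB … Adm bd Dat …` (Node00 `Record12BgRowCoClassCPMFloorB`) FROM THE GUARDED TOP STEP OF PROPOSITION 8 OVER `(bd, Dat)`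
# (`Node00.Prop8RegSepTopStepGB`, F0c `CriticalOnFibreTopGuardedB`): the `(bd, Dat)` twin of module 53 `…N07Thm1Top7FromProp8Guarded`

Cell `pub-ymgap`, seat `pub-ymgap-k0-s1-w1` g9 (K0⁷ **stmt-QuantumFields-20541** helper lane; (E1)∕(iii-b) work plan WORKPLAN-IIIB 27c850bec22d4efe; director-ym №338 ∕ №339 (α);
FLAG №16 ∕ LOCATE-HSEAM 5d3298b8d191f169; kernel road-scan ROADSCAN-IIIB-g9 53ea8804079dcb1a: module 53's `variationalThm1RegSepCoP7MG_of_prop8TopStepG` lies on the K0⁷ body's road).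
`--kind proof --supports stmt-QuantumFields-20541 --as helper` (count-neutral).  THEOREMS ONLY (0 `def`, 0 `sorry`).  PURELY ADDITIVE — «print-datum twin of
`Thm/…N07Thm1Top7FromProp8Guarded` (FLAG №16 ∕ LOCATE-HSEAM 5d3298b8d191f169); the (b)-instance `variationalThm1RegSep{Top,CoP}7MG_of_prop8TopStepG` stays landed and true on its own text»;
no displayed premise is deleted or weakened: the one NEW displayed premise is the `k = 0` admissibility of the unit configuration on the `bd`-fibre (`h1`), which the (b)-datum and every
SMALLER datum (print's `lamDatum` included) satisfy with no hypothesis (`agreeOnB_one_seq_zero_of_subset_genSetDatum`).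

WHY.  Module 53 derives the guarded (8)-sentence for minimisers from Prop. 8's guarded top step: at a genuine step `1 ≤ k` by «minimal over the open class ⇒ critical ⇒ Prop. 8»
(Node00 module 53-G :314), at `k = 0` by FLATNESS of the unconstrained minimiser (`dist1_plaqHol_eq_zero_of_isMinimizer_classTop_zero`: the determining set `genSet s.Ω 0` is EMPTY, so `1`
lies in the fibre and `A(U₀) ≤ A(1) = 0`).  Over a bond-datum family `bd : BondDatum F` the genuine step is `Record12BgRowCoClassCPMFloorB.regular_of_isMinimizerB_classTop_of_prop8TopStepGB`
(its `_of_zero` door displays the flat clause); the flat clause needs exactly «`1` is `bd`-admissible at `k = 0`» (`AgreeOnB (bd K 0 s.Ω) (Ū 1) W`), which holds for every datum contained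
levelwise in reading (b)'s (`bd ⊆ genSetDatum`, by `AgreeOnB.anti` from `B16Thm1BaseAtRecord11.agreeOn_genSet_seq_zero`) — in particular for print's [II] (2.3) datum `lamDatum F` (F0c
`lamDatum_subset_genSetDatum`, no hypotheses).

WHAT IS PROVED.  §1 `dist1_plaqHol_eq_zero_of_isMinimizerB_classTop_zero` (flatness at `k = 0` for a `𝔅`-minimiser with `1` in the fibre), `agreeOnB_one_seq_zero_of_subset_genSetDatum`,
`agreeOnB_one_seq_zero_lamDatum`.  §2 ★ `variationalThm1RegSepTop7MGB_of_prop8TopStepGB (Sup) (hB : 0 < B₃) (h1) (h8 : Prop8RegSepTopStepGB F N Sup Adm bd Dat B₃ a₀ a₁) :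
VariationalThm1RegSepTop7MGB F N Sup Adm bd Dat B₃ a₀ a₁`, ★ `…_of_subset_genSetDatum` (`bd ⊆ genSetDatum` levelwise — no `h1`), ★★ `variationalThm1RegSepCoP7MGB_of_prop8TopStepGB_of_subset_genSetDatum`
(at `Sup := suppDomOfRecord`), ★★ `variationalThm1RegSepCoP7MGB_of_prop8TopStepGB_lamDatum` (PRINT's datum, any `Dat`: the door the V23 road's stub 1 ⇒ (8) link runs through),
`variationalThm1RegSepCoP7MGB_of_halvingStepTopGB_lamDatum` (from Sect. F's one-step token, F0c `prop8RegSepTopStepGB_of_halvingStepTopGB`); at `(genSetDatum, dataSmall7PTopOf)` the new bridge IS module 53's (same statement — not re-declared, module 53 stays the (b)-road's citation).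
HONEST FRAMING: count-neutral kernel bookkeeping + the elementary flatness step; Prop. 8 NOT claimed in any reading; nothing of Bałaban asserted; `stub_prop8StepCoPGridG13` ∕ K0⁷ NOT closed;
N07 NOT discharged; counts unmoved (typed 28∕28 · discharged 8∕28); one finite 𝕋⁴ programme at fixed ε — R4 closes the conditional finite-𝕋⁴ rung `BalabanLadder.UV` only; NOT continuum ∕
ℝ⁴ ∕ OS; the Yang–Mills mass gap (Clay) is NOT proved by any of this.

DEPENDENCES (by name): module 53's parent `…N07Thm1Top7FromProp8` (imports of `dist1_plaqHol_sq_le_wilsonAction4`, `norm_coDivSum_le`, `B10Eq2DensityTower.wilsonAction4_one`,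
`B16Thm1BaseAtRecord11.agreeOn_genSet_seq_zero`), F0a `AgreeOnB ∕ IsMinimizerB ∕ AgreeOnB.anti`, F0c `BondDatum ∕ TopData ∕ genSetDatum ∕ lamDatum ∕ dataSmall7PTopOf ∕ Prop8RegSepTopStepGB ∕
HalvingStepTopGB ∕ prop8RegSepTopStepGB_of_halvingStepTopGB ∕ lamDatum_subset_genSetDatum ∕ prop8RegSepTopStepG_iff_GB`, S1a-C `VariationalThm1RegSepTop7MGB ∕ …CoP7MGB ∕
variationalThm1RegSepTop7MGB_of_prop8RegSepTopStepGB_of_zero ∕ variationalThm1RegSepCoP7MG_iff_GB`.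
[B11] = [Balaban1985Variational] Thm 1 (5)–(8) pp.278–279, p.299, Prop. 8 p.304; [6] = [Balaban1985RegularSpaces] (1.3)–(1.10) p.77; [II] = [Balaban1984PropagatorsII] (2.3) p.224;
[III] = [Balaban1988Convergent] (2.2) p.255, (2.10)–(2.12) p.256; [I] = [Balaban1987RG1] (0.1) p.251.
-/

noncomputable section

namespace Summit.QuantumFields.YangMills.BalabanUVNodes.N07Thm1Top7FromProp8GuardedB

open Literature.MathematicalPhysics.QuantumFieldTheory.Balaban1983to89
open Literature.MathematicalPhysics.QuantumFieldTheory.Balaban1983to89.T4Continuum (T4Family)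
open Literature.MathematicalPhysics.QuantumFieldTheory.Balaban1983to89.Node00
open Literature.MathematicalPhysics.QuantumFieldTheory.Balaban1983to89.B15DeterminingSets
open Literature.MathematicalPhysics.QuantumFieldTheory.Balaban1983to89.B15DeterminingSetsB
open Summit.QuantumFields.YangMills.BalabanUVNodes.N07SmallActionBoundaryAvoidance (dist1_plaqHol_sq_le_wilsonAction4)
open Summit.QuantumFields.YangMills.BalabanUVNodes.N07FaceDatumAverage (norm_coDivSum_le)
open scoped Matrix.Norms.L2Operator

variable {F : T4Family} {N : ℕ} [NeZero N]

/-! ## §1  Flatness of the unconstrained minimiser at `k = 0`, over a bond datum -/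

/-- **AT `k = 0` A `𝔅`-MINIMISER OVER PRINT'S CLASS (6) ON A TOP DOMAIN IS FLAT, PROVIDED `1` LIES IN THE `𝔅`-FIBRE**: the class contains `1` (`ε₀ > 0`), so `A(U₀) ≤ A(1) = 0` and every
plaquette of `U₀` has `dist1 = 0` (bond-datum twin of module 53's `dist1_plaqHol_eq_zero_of_isMinimizer_classTop_zero`; for the (b)-datum `h1` is automatic — the determining set is empty).
[cite: Balaban1985Variational, (5)–(6) p.278; Balaban1985RegularSpaces, (1.10) p.77; Balaban1988Convergent, (2.12) p.256] -/
theorem dist1_plaqHol_eq_zero_of_isMinimizerB_classTop_zero {ν : Stage7Numerics} {M : ℕ} {g : ℕ → ℝ} {K : ℕ} (s : SeqOfRecord F ν M g K 0)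
    {Ω₀ : Set (Site (F.P K) 0)} {ε₀ : ℝ} (hε₀ : 0 < ε₀) {𝔅 : BDetSet (F.P K)} {W : MSField (F.P K) (SU N)} {U₀ : GaugeField (F.P K) 0 (SU N)}
    (h1 : AgreeOnB 𝔅 (avgFamily (avOfRecord F N K) 1) W)
    (hU₀ : IsMinimizerB (avOfRecord F N K)
      {U | (∀ n, n ≤ 0 → PlaqSmallOn (Sect2.omegaPlaqsTop s.Ω Ω₀ n) (ε₀ * (F.P K).eta n ^ 2) U) ∧ Sect2.CoDivClassOnTop s.Ω Ω₀ 0 ε₀ U} 𝔅 W U₀)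
    (q : Plaq (F.P K) 0) : dist1 (GaugeField.plaqHol U₀ q) = 0 := by
  have hη : ∀ n, 0 < (F.P K).eta n := fun n => pow_pos (inv_pos.mpr (by exact_mod_cast (F.P K).L_pos)) n
  have h1plaq : ∀ q : Plaq (F.P K) 0, dist1 (GaugeField.plaqHol (1 : GaugeField (F.P K) 0 (SU N)) q) ≤ 0 := fun q => by
    show dist1 ((1 : SU N) * 1 * 1⁻¹ * 1⁻¹) ≤ 0
    rw [inv_one, mul_one, mul_one, mul_one, GaugeGroup.dist1_one]
  have h1cls : (1 : GaugeField (F.P K) 0 (SU N)) ∈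
      {U | (∀ n, n ≤ 0 → PlaqSmallOn (Sect2.omegaPlaqsTop s.Ω Ω₀ n) (ε₀ * (F.P K).eta n ^ 2) U) ∧ Sect2.CoDivClassOnTop s.Ω Ω₀ 0 ε₀ U} := by
    refine ⟨fun n _ q _ => (h1plaq q).trans_lt (mul_pos hε₀ (pow_pos (hη n) 2)), fun j _ b _ => ?_⟩
    have h := norm_coDivSum_le (1 : GaugeField (F.P K) 0 (SU N)) le_rfl h1plaq b.src b.dir
    rw [mul_zero, mul_zero] at h
    exact h.trans_lt (mul_pos hε₀ (pow_pos (hη j) 3))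
  have hA : wilsonAction4 U₀ ≤ 0 := by
    have h := hU₀.2.2 1 h1cls h1
    have h0 : wilsonAction4 (1 : GaugeField (F.P K) 0 (SU N)) = 0 := B10Eq2DensityTower.wilsonAction4_one
    linarith
  have hsq := dist1_plaqHol_sq_le_wilsonAction4 U₀ q
  have hN : (0 : ℝ) ≤ 2 * N := by positivity
  have h2 : 2 * (N : ℝ) * wilsonAction4 U₀ ≤ 0 := mul_nonpos_of_nonneg_of_nonpos hN hA
  have h3 : dist1 (GaugeField.plaqHol U₀ q) ^ 2 = 0 := le_antisymm (hsq.trans h2) (sq_nonneg _)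
  exact pow_eq_zero_iff (two_ne_zero) |>.mp h3

omit [NeZero N] in
/-- **`1` IS ADMISSIBLE AT `k = 0` FOR EVERY DATUM CONTAINED IN READING (b)'s**: at length `0` the (2.2) determining set `genSet s.Ω 0` is empty (`agreeOn_genSet_seq_zero`), hence so is every
`bd K 0 s.Ω ⊆ genSetDatum F K 0 s.Ω` levelwise, and ANY two multi-scale fields agree on it. [cite: Balaban1988Convergent, (2.2) p.255, (2.10) p.256; Balaban1987RG1, (0.1) p.251] -/
theorem agreeOnB_seq_zero_of_subset_genSetDatum {bd : BondDatum F} (hbd : ∀ (K k : ℕ) (Ω : ℕ → Set (Site (F.P K) 0)) (j : ℕ), bd K k Ω j ⊆ genSetDatum F K k Ω j)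
    {ν : Stage7Numerics} {M : ℕ} {g : ℕ → ℝ} {K : ℕ} (s : SeqOfRecord F ν M g K 0) (V W : MSField (F.P K) (SU N)) : AgreeOnB (bd K 0 s.Ω) V W :=
  AgreeOnB.anti (hbd K 0 s.Ω) (show AgreeOnB (genSetDatum F K 0 s.Ω) V W from B16Thm1BaseAtRecord11.agreeOn_genSet_seq_zero F N s V W)

omit [NeZero N] in
/-- In particular for PRINT's [II] (2.3) datum `lamDatum F` (F0c `lamDatum_subset_genSetDatum`, no hypotheses). [cite: Balaban1984PropagatorsII, (2.3) p.224; Balaban1988Convergent, (2.2) p.255] -/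
theorem agreeOnB_seq_zero_lamDatum {ν : Stage7Numerics} {M : ℕ} {g : ℕ → ℝ} {K : ℕ} (s : SeqOfRecord F ν M g K 0) (V W : MSField (F.P K) (SU N)) :
    AgreeOnB (lamDatum F K 0 s.Ω) V W :=
  agreeOnB_seq_zero_of_subset_genSetDatum (lamDatum_subset_genSetDatum (F := F)) s V W

/-! ## §2  The guarded (8)-sentence over `(bd, Dat)` from Proposition 8's guarded top step over `(bd, Dat)` -/

/-- ★ **THE GUARDED TOP-DOMAIN (8)-SENTENCE OVER `(bd, Dat)` (Node00 `Record12BgRowCoClassCPMFloorB` §1) FROM THE GUARDED TOP STEP OF PROPOSITION 8 OVER `(bd, Dat)` (F0c)**, for `0 < B₃`,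
ANY support selector `Sup`, ANY guard `Adm`, ANY data predicate `Dat`, and any bond-datum family `bd` whose `k = 0` fibre contains the unit configuration (`h1`): at a genuine step by
`regular_of_isMinimizerB_classTop_of_prop8TopStepGB` (minimal over the open class ⇒ critical on the `bd`-fibre ⇒ Prop. 8, at prefixes passing the guard), at `k = 0` by flatness (§1, guard-
and data-blind). [cite: Balaban1985Variational, Thm 1 (6)–(8) pp.278–279, p.299, Prop. 8 p.304, p.304 lines 1–2; Balaban1985RegularSpaces, (1.3)–(1.6) p.77; Balaban1988Convergent, (2.12) p.256; Balaban1984PropagatorsII, (2.3) p.224; Balaban1987RG1, (0.1) p.251] -/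
theorem variationalThm1RegSepTop7MGB_of_prop8TopStepGB (Sup : (ν : Stage7Numerics) → (K : ℕ) → (ℕ → Set (Site (F.P K) 0)) → Set (Site (F.P K) 0))
    {Adm : StepGuard F} {bd : BondDatum F} {Dat : TopData F N} {B₃ a₀ a₁ : ℝ} (hB : 0 < B₃)
    (h1 : ∀ (ν : Stage7Numerics) (M : ℕ) (g : ℕ → ℝ) (K : ℕ) (s : SeqOfRecord F ν M g K 0) (W : MSField (F.P K) (SU N)), AgreeOnB (bd K 0 s.Ω) (avgFamily (avOfRecord F N K) 1) W)
    (h8 : Prop8RegSepTopStepGB F N Sup Adm bd Dat B₃ a₀ a₁) :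
    VariationalThm1RegSepTop7MGB F N Sup Adm bd Dat B₃ a₀ a₁ := by
  refine variationalThm1RegSepTop7MGB_of_prop8RegSepTopStepGB_of_zero h8 ?_
  intro ν M g K s _hsep _hM₁ _hadm ε₀ δ hδ _hε₀ W _h7 U₀ hU₀
  -- `k = 0`: the unconstrained minimiser is flat (no guard, no data is read)
  have hε₀pos : 0 < ε₀ := lt_of_lt_of_le (mul_pos hB hδ.1) hδ.2.2
  have hη : ∀ n, 0 < (F.P K).eta n := fun n => pow_pos (inv_pos.mpr (by exact_mod_cast (F.P K).L_pos)) n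
  have hflat : ∀ q, dist1 (GaugeField.plaqHol U₀ q) ≤ 0 := fun q =>
    le_of_eq (dist1_plaqHol_eq_zero_of_isMinimizerB_classTop_zero s hε₀pos (h1 ν M g K s W) hU₀ q)
  refine ⟨fun q _ => (hflat q).trans_lt (mul_pos (mul_pos hB hδ.1) (pow_pos (hη 0) 2)), fun b _ => ?_⟩
  have h := norm_coDivSum_le U₀ le_rfl hflat b.src b.dir
  rw [mul_zero, mul_zero] at h
  exact h.trans_lt (mul_pos (mul_pos hB hδ.1) (pow_pos (hη 0) 3))

/-- ★ The same for every bond-datum family CONTAINED LEVELWISE IN READING (b)'s (`bd ⊆ genSetDatum`) — no `k = 0` hypothesis left. [cite: Balaban1985Variational, Thm 1 (6)–(8) pp.278–279, Prop. 8 p.304; Balaban1988Convergent, (2.2) p.255, (2.12) p.256] -/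
theorem variationalThm1RegSepTop7MGB_of_prop8TopStepGB_of_subset_genSetDatum (Sup : (ν : Stage7Numerics) → (K : ℕ) → (ℕ → Set (Site (F.P K) 0)) → Set (Site (F.P K) 0))
    {Adm : StepGuard F} {bd : BondDatum F} {Dat : TopData F N} {B₃ a₀ a₁ : ℝ} (hB : 0 < B₃)
    (hbd : ∀ (K k : ℕ) (Ω : ℕ → Set (Site (F.P K) 0)) (j : ℕ), bd K k Ω j ⊆ genSetDatum F K k Ω j)
    (h8 : Prop8RegSepTopStepGB F N Sup Adm bd Dat B₃ a₀ a₁) :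
    VariationalThm1RegSepTop7MGB F N Sup Adm bd Dat B₃ a₀ a₁ :=
  variationalThm1RegSepTop7MGB_of_prop8TopStepGB Sup hB (fun _ _ _ _ s W => agreeOnB_seq_zero_of_subset_genSetDatum hbd s _ W) h8

/-- ★★ **THE GUARDED `CoP` (8)-SENTENCE OVER `(bd, Dat)` FROM PROPOSITION 8's GUARDED TOP STEP OVER `(bd, Dat)`** at node00-def-R's support selector, for every `bd ⊆ genSetDatum` levelwise.
[cite: Balaban1985Variational, Thm 1 (6)–(8) pp.278–279, Prop. 8 p.304, p.304 lines 1–2; Balaban1988Convergent, p.255, (2.12) p.256; Balaban1987RG1, (0.1) p.251] -/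
theorem variationalThm1RegSepCoP7MGB_of_prop8TopStepGB_of_subset_genSetDatum {Adm : StepGuard F} {bd : BondDatum F} {Dat : TopData F N} {B₃ a₀ a₁ : ℝ} (hB : 0 < B₃)
    (hbd : ∀ (K k : ℕ) (Ω : ℕ → Set (Site (F.P K) 0)) (j : ℕ), bd K k Ω j ⊆ genSetDatum F K k Ω j)
    (h8 : Prop8RegSepTopStepGB F N (fun ν K Ω => suppDomOfRecord F ν K Ω) Adm bd Dat B₃ a₀ a₁) :
    VariationalThm1RegSepCoP7MGB F N Adm bd Dat B₃ a₀ a₁ :=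
  variationalThm1RegSepTop7MGB_of_prop8TopStepGB_of_subset_genSetDatum (fun ν K Ω => suppDomOfRecord F ν K Ω) hB hbd h8

/-- ★★ **AT PRINT's [II] (2.3) DATUM**: the guarded `CoP` (8)-sentence for `Λ`-minimisers, any data predicate `Dat` (the (7) predicate of the print datum is §7′'s; this door does not read it),
from Proposition 8's guarded top step on the `Λ`-fibre — the link a V23 stub-1 text `Prop8RegSepTopStepGB … (lamDatum F) Dat …` ⇒ the (8)-sentence runs through.
[cite: Balaban1985Variational, Thm 1 (6)–(8) pp.278–279, Prop. 8 p.304; Balaban1984PropagatorsII, (2.3) p.224; Balaban1988Convergent, (2.12) p.256] -/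
theorem variationalThm1RegSepCoP7MGB_of_prop8TopStepGB_lamDatum {Adm : StepGuard F} {Dat : TopData F N} {B₃ a₀ a₁ : ℝ} (hB : 0 < B₃)
    (h8 : Prop8RegSepTopStepGB F N (fun ν K Ω => suppDomOfRecord F ν K Ω) Adm (lamDatum F) Dat B₃ a₀ a₁) :
    VariationalThm1RegSepCoP7MGB F N Adm (lamDatum F) Dat B₃ a₀ a₁ :=
  variationalThm1RegSepCoP7MGB_of_prop8TopStepGB_of_subset_genSetDatum hB (lamDatum_subset_genSetDatum (F := F)) h8

/-- At print's datum, from Sect. F's guarded ONE-STEP token over `(bd, Dat)` (F0c `prop8RegSepTopStepGB_of_halvingStepTopGB`, same guard, `0 < B₃`).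
[cite: Balaban1985Variational, Thm 1 (6)–(8) pp.278–279, Sect. F p.304, Prop. 8 p.304 (bookkeeping)] -/
theorem variationalThm1RegSepCoP7MGB_of_halvingStepTopGB_lamDatum {Adm : StepGuard F} {Dat : TopData F N} {B₃ a₀ a₁ : ℝ} (hB : 0 < B₃)
    (hH : HalvingStepTopGB F N (fun ν K Ω => suppDomOfRecord F ν K Ω) Adm (lamDatum F) Dat B₃ a₀ a₁) :
    VariationalThm1RegSepCoP7MGB F N Adm (lamDatum F) Dat B₃ a₀ a₁ :=
  variationalThm1RegSepCoP7MGB_of_prop8TopStepGB_lamDatum hB (prop8RegSepTopStepGB_of_halvingStepTopGB hB hH)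

/- SANITY (not re-declared — `dedup.landed`): at `(genSetDatum F, dataSmall7PTopOf F N)` the bridge
`variationalThm1RegSepCoP7MGB_of_prop8TopStepGB_of_subset_genSetDatum hB (fun _ _ _ _ => subset_rfl) (prop8RegSepTopStepG_iff_GB.1 h8)` read back through
`variationalThm1RegSepCoP7MG_iff_GB` IS module 53's `variationalThm1RegSepCoP7MG_of_prop8TopStepG hB h8` (same statement; the gate identifies them), so the (b)-road keeps citing module 53. -/

end Summit.QuantumFields.YangMills.BalabanUVNodes.N07Thm1Top7FromProp8GuardedB

end
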